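import Literature.NumberTheory.EllipticCurves.ModPImageScalarProofs
import HarnessLib

/-!
# A non-trivial scalar in the mod-`3` image at an irreducible, non-surjective `3` (`E/ℚ`)

Topic `NumberTheory/EllipticCurves`; theorems only. The `p = 3` twin of
`ModPImageScalarProofs` (`WeierstrassCurve.exists_galoisRepTorsion_eq_smul_of_not_surjective`,
stated there for `p ≥ 5` because its group-theoretic core `Serre1972.exists_mat_eq_smul_one_ne_one`
runs through Serre's n° 2.6 trichotomy at `p ≥ 5`). At `p = 3` the argument is shorter and different:

**Theorem** (`Serre1972.exists_mat_eq_neg_one_of_three`). Let `G ≤ GL₂(𝔽₃)` have order prime to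
`3` and no common eigenvector. Then `-1 ∈ G`.

Proof. `#GL₂(𝔽₃) = 48 = 2⁴·3`, so `G` is a `2`-group; it is non-trivial (the trivial group fixes
every line), hence has a non-trivial centre, hence a CENTRAL involution `z`. An involution `z ≠ ±1`
of `𝔽₃²` has the two eigenvalues `1` and `-1`; its `1`-eigenline is preserved by everything that
commutes with `z`, i.e. by `G` — a common eigenvector, contradiction. So `z = -1`.
(`exists_le_eigenvectorStabilizer_of_central_involution` is the eigenline step, valid over any field.)

**Corollary** (`WeierstrassCurve.exists_galoisRepTorsion_eq_smul_of_not_surjective_three`). For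
`E = W/ℚ` with `E[3]` irreducible and `ρ̄_{E,3}` not surjective, some `σ ∈ Γ_ℚ` acts on `E[3]` as a
scalar `a ≠ 1` (namely `-1`): the image has surjective determinant, fixes no line, is proper, hence
has order prime to `3` (Serre's Prop. 15, `not_dvd_natCard_of_forall_not_le_eigenvectorStabilizer`),
and the theorem applies. The images concerned are the normaliser-of-Cartan types 3Ns / 3Nn (orders
`8`, `16`) of the residual class X10b of the BSD rank-`≤ 1` census.

Why it matters: this is the field-theoretic input (F2)/(F8) of the cell theorem
`pub/bsd-smallim/koly/MU-TRANSFER-PROOF.md` (Kato `μ`-transfer without surjectivity) at `p = 3`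
(KOLY-MEMO Remark 5.7.1′ (4): the scalar `-1` serves Sah's lemma, and `3 ∤ #Ḡ` makes
`ℚ(E[3]) ∩ ℚ(μ_{3^∞}) = ℚ(μ_3)`), i.e. of the typed node `KatoMuTransferThree` of
`Summits/…/Theorems/Rank1ResidualX10bMuTransfer.lean`; at `p ≥ 5` the same role is played by
`exists_galoisRepTorsion_eq_smul_of_not_surjective`.

## References

* [Serre1972] J.-P. Serre, Invent. Math. 15 (1972) 259–331, §2.4 Prop. 15, §2.6.
-/

noncomputable section

open scoped Classical
open Matrix Field

namespace Literature.NumberTheory.GaloisRepresentations.Serre1972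

/-! ### Linear algebra in dimension two: the fixed space of a non-identity matrix is a line -/

/-- For a `2 × 2` matrix `M ≠ 1` over a field and a non-zero fixed vector `v` (`M v = v`), every
fixed vector is a multiple of `v`: the fixed space is a proper subspace of the plane containing the
line through `v`, hence equal to it. [folklore] -/
private theorem exists_smul_eq_of_mulVec_eq_self {K : Type*} [Field K] {M : Matrix (Fin 2) (Fin 2) K}
    (hM1 : M ≠ 1) {v : Fin 2 → K} (hv : v ≠ 0) (hMv : M *ᵥ v = v) (u : Fin 2 → K)
    (hMu : M *ᵥ u = u) : ∃ c : K, c • v = u := by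
  let f : (Fin 2 → K) →ₗ[K] (Fin 2 → K) := Matrix.mulVecLin M - LinearMap.id
  let S : Submodule K (Fin 2 → K) := LinearMap.ker f
  have hmem : ∀ x : Fin 2 → K, x ∈ S ↔ M *ᵥ x = x := by
    intro x
    change f x = 0 ↔ _
    simp only [f, LinearMap.sub_apply, Matrix.mulVecLin_apply, LinearMap.id_apply, sub_eq_zero]
  have hvS : v ∈ S := (hmem v).mpr hMv
  have huS : u ∈ S := (hmem u).mpr hMu
  -- `S ≠ ⊤` because `M ≠ 1`
  have hStop : S ≠ ⊤ := by
    intro htop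
    apply hM1
    ext i j
    have hx : (Pi.single j (1 : K) : Fin 2 → K) ∈ S := htop ▸ Submodule.mem_top
    rw [hmem, Matrix.mulVec_single_one] at hx
    have hij := congrFun hx i
    rw [Matrix.col_apply] at hij
    rw [hij, Matrix.one_apply, Pi.single_apply]
  -- hence `finrank S = 1`
  have hlt : Module.finrank K S < 2 := by
    have h := Submodule.finrank_lt hStop
    rwa [Module.finrank_fin_fun] at h
  have hge : 1 ≤ Module.finrank K S :=
    Submodule.one_le_finrank_iff.mpr ((Submodule.ne_bot_iff S).mpr ⟨v, hvS, hv⟩)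
  have h1 : Module.finrank K S = 1 := by omega
  have hv' : (⟨v, hvS⟩ : S) ≠ 0 := by
    intro h
    apply hv
    exact congrArg Subtype.val h
  obtain ⟨c, hc⟩ := (finrank_eq_one_iff_of_nonzero' (⟨v, hvS⟩ : S) hv').mp h1 ⟨u, huS⟩
  exact ⟨c, by simpa using congrArg Subtype.val hc⟩

/-- **The eigenline of a central involution.** If `y ∈ G ≤ GL₂(K)` commutes with every element
of `G` and `y² = 1`, `y ≠ 1`, `y ≠ -1` (as matrices), then `G` has a common eigenvector: the
`1`-eigenline of `y` (non-zero as `y ≠ -1`, a line as `y ≠ 1`) is preserved by the centraliser of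
`y`. [folklore] -/
private theorem exists_le_eigenvectorStabilizer_of_central_involution {K : Type*} [Field K]
    (G : Subgroup (GL (Fin 2) K)) (y : G) (hcen : ∀ g : G, g * y = y * g)
    (hyy : (y.1 : Matrix (Fin 2) (Fin 2) K) * (y.1 : Matrix (Fin 2) (Fin 2) K) = 1)
    (hy1 : (y.1 : Matrix (Fin 2) (Fin 2) K) ≠ 1) (hyneg : (y.1 : Matrix (Fin 2) (Fin 2) K) ≠ -1) :
    ∃ (v : Fin 2 → K) (hv : v ≠ 0), G ≤ eigenvectorStabilizer v hv := by
  set M : Matrix (Fin 2) (Fin 2) K := (y.1 : Matrix (Fin 2) (Fin 2) K) with hM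
  -- `N := M + 1 ≠ 0`, so some `w` has `v := N w ≠ 0`
  have hN : M + 1 ≠ 0 := by
    intro h
    exact hyneg (eq_neg_of_add_eq_zero_left h)
  have hex : ¬ ∀ w : Fin 2 → K, (M + 1) *ᵥ w = 0 := by
    intro h
    apply hN
    ext i j
    have := congrFun (h (Pi.single j 1)) i
    rwa [Matrix.mulVec_single_one, Matrix.col_apply] at this
  obtain ⟨w, hw⟩ := not_forall.mp hex
  set v : Fin 2 → K := (M + 1) *ᵥ w with hvdef
  -- `v` is fixed by `M` (`M(M+1) = M + 1`)
  have hMv : M *ᵥ v = v := by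
    rw [hvdef, Matrix.mulVec_mulVec, mul_add, hyy, mul_one, add_comm]
  refine ⟨v, hw, fun h hh => ?_⟩
  -- `h ∈ G` commutes with `M`, so `h v` is fixed by `M`, hence a multiple of `v`
  have hcomm : (h : Matrix (Fin 2) (Fin 2) K) * M = M * (h : Matrix (Fin 2) (Fin 2) K) := by
    have h1 := hcen ⟨h, hh⟩
    have h2 := congrArg (fun g : G => ((g.1 : GL (Fin 2) K) : Matrix (Fin 2) (Fin 2) K)) h1
    simpa [hM] using h2
  have hfix : M *ᵥ ((h : Matrix (Fin 2) (Fin 2) K) *ᵥ v) = (h : Matrix (Fin 2) (Fin 2) K) *ᵥ v := by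
    rw [Matrix.mulVec_mulVec, ← hcomm, ← Matrix.mulVec_mulVec, hMv]
  obtain ⟨c, hc⟩ := exists_smul_eq_of_mulVec_eq_self hy1 hw hMv _ hfix
  exact ⟨c, hc.symm⟩

/-! ### `GL₂(𝔽₃)`: a subgroup of order prime to `3` without a fixed line contains `-1` -/

/-- `#GL₂(𝔽₃) = 48`. [folklore] -/
private theorem natCard_GL_two_zmod_three : Nat.card (GL (Fin 2) (ZMod 3)) = 48 := by
  rw [Matrix.card_GL_field]
  simp [Fin.prod_univ_two, ZMod.card]

/-- **`p = 3`: an irreducible subgroup of `GL₂(𝔽₃)` of order prime to `3` contains `-1`**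
(the `p = 3` case of Serre 1972, §2.6 / memo Lemma 2.3 (a)): `G` is a non-trivial `2`-group, a
central involution exists, and by `exists_le_eigenvectorStabilizer_of_central_involution` it must be
`-1`. Stated in the shape of `exists_mat_eq_smul_one_ne_one` (a scalar `a • 1`, `a ≠ 1`, with
`a = -1`). [cite: Serre1972, §2.4 Prop. 15 and §2.6] -/
theorem exists_mat_eq_smul_one_ne_one_three (G : Subgroup (GL (Fin 2) (ZMod 3)))
    (hG : ¬ 3 ∣ Nat.card G)
    (hirr : ∀ (v : Fin 2 → ZMod 3) (hv : v ≠ 0), ¬ G ≤ eigenvectorStabilizer v hv) :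
    ∃ z : G, ∃ a : ZMod 3, a ≠ 1 ∧ z.1.1 = a • 1 := by
  -- `G` is a `2`-group
  have hdvd : Nat.card G ∣ 16 * 3 := by
    have h := Subgroup.card_subgroup_dvd_card G
    rwa [natCard_GL_two_zmod_three] at h
  have hcop : Nat.Coprime (Nat.card G) 3 :=
    (Nat.coprime_comm).mp ((Nat.Prime.coprime_iff_not_dvd Nat.prime_three).mpr hG)
  have h16 : Nat.card G ∣ 2 ^ 4 := by
    simpa using Nat.Coprime.dvd_of_dvd_mul_right hcop hdvd
  obtain ⟨k, -, hk⟩ := (Nat.dvd_prime_pow Nat.prime_two).mp h16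
  have hP : IsPGroup 2 G := IsPGroup.of_card hk
  -- `G` is non-trivial (the trivial group fixes a line)
  have hne : G ≠ ⊥ := by
    intro hbot
    refine hirr (Pi.single 0 1) (by simp) ?_
    intro h hh
    rw [hbot, Subgroup.mem_bot] at hh
    subst hh
    exact ⟨1, by rw [Units.val_one, Matrix.one_mulVec, one_smul]⟩
  haveI : Nontrivial G := (Subgroup.nontrivial_iff_ne_bot G).mpr hne
  -- a central element of order `2`
  haveI : Nontrivial (Subgroup.center G) := hP.center_nontrivial
  have hPZ : IsPGroup 2 (Subgroup.center G) := hP.to_subgroup _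
  obtain ⟨n, hn, hZ⟩ := hPZ.nontrivial_iff_card.mp inferInstance
  have h2 : 2 ∣ Nat.card (Subgroup.center G) := hZ ▸ dvd_pow_self 2 hn.ne'
  obtain ⟨z, hz⟩ := exists_prime_orderOf_dvd_card' 2 h2
  set y : G := (z : G) with hy
  have hcen : ∀ g : G, g * y = y * g := fun g => (Subgroup.mem_center_iff.mp z.2 g)
  have hord : orderOf y = 2 := by rw [hy, Subgroup.orderOf_coe, hz]
  have hyy' : y * y = 1 := by
    have h := pow_orderOf_eq_one y
    rw [hord, pow_two] at h
    exact h
  have hy1' : y ≠ 1 := by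
    intro h
    rw [h, orderOf_one] at hord
    exact absurd hord (by decide)
  -- as matrices
  have hyy : (y.1 : Matrix (Fin 2) (Fin 2) (ZMod 3)) * (y.1 : Matrix (Fin 2) (Fin 2) (ZMod 3)) = 1 := by
    have h := congrArg (fun g : G => ((g.1 : GL (Fin 2) (ZMod 3)) : Matrix (Fin 2) (Fin 2) (ZMod 3)))
      hyy'
    simpa using h
  have hy1 : (y.1 : Matrix (Fin 2) (Fin 2) (ZMod 3)) ≠ 1 := by
    intro h
    apply hy1'
    exact Subtype.ext (Units.ext h)
  by_cases hneg : (y.1 : Matrix (Fin 2) (Fin 2) (ZMod 3)) = -1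
  · refine ⟨y, -1, by decide, ?_⟩
    rw [hneg, neg_one_smul]
  · obtain ⟨v, hv, hle⟩ := exists_le_eigenvectorStabilizer_of_central_involution G y hcen hyy hy1 hneg
    exact absurd hle (hirr v hv)

/-- The scalar of `exists_mat_eq_smul_one_ne_one_three` may be taken to be `-1`: `-1 ∈ G`.
[cite: Serre1972, §2.6] -/
theorem exists_mat_eq_neg_one_of_three (G : Subgroup (GL (Fin 2) (ZMod 3)))
    (hG : ¬ 3 ∣ Nat.card G)
    (hirr : ∀ (v : Fin 2 → ZMod 3) (hv : v ≠ 0), ¬ G ≤ eigenvectorStabilizer v hv) :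
    ∃ z : G, z.1.1 = -1 := by
  obtain ⟨z, a, ha1, hz⟩ := exists_mat_eq_smul_one_ne_one_three G hG hirr
  -- a scalar `a • 1 ∈ GL₂(𝔽₃)` with `a ≠ 1` has `a = -1` (`a ≠ 0` by invertibility)
  have ha0 : a ≠ 0 := by
    intro h
    have hdet : IsUnit (Matrix.det (z.1 : Matrix (Fin 2) (Fin 2) (ZMod 3))) :=
      (Matrix.isUnit_iff_isUnit_det _).mp z.1.isUnit
    rw [hz, h, zero_smul, Matrix.det_zero] at hdet
    exact not_isUnit_zero hdet
  have hall : ∀ b : ZMod 3, b ≠ 0 → b ≠ 1 → b = -1 := by decide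
  have ha : a = -1 := hall a ha0 ha1
  exact ⟨z, by rw [hz, ha, neg_one_smul]⟩

end Literature.NumberTheory.GaloisRepresentations.Serre1972

/-! ### The elliptic-curve form at `p = 3` -/

namespace WeierstrassCurve

open Literature.NumberTheory.EllipticCurves Literature.NumberTheory.GaloisRepresentations
  Literature.NumberTheory.GaloisRepresentations.Serre1972

variable (W : WeierstrassCurve ℚ) [W.IsElliptic] (p : ℕ) [Fact p.Prime]

/-- **A Galois element acting on `E[3]` by the scalar `-1`** exists as soon as `E[3]` is
irreducible and `ρ̄_{E,3}` is not surjective (images 3Ns/3Nn): in a frame the image has surjective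
determinant and no fixed line, is proper, hence of order prime to `3` (Serre Prop. 15), and
`Serre1972.exists_mat_eq_smul_one_ne_one_three` applies. The prime is carried as a variable `p` with
`p = 3` (the shape of the tree's `p = 3` statements, e.g. `KatoMuTransferThree`), and the conclusion
is that of `exists_galoisRepTorsion_eq_smul_of_not_surjective` verbatim, so consumers written for
`p ≥ 5` port unchanged. [cite: Serre1972, §2.4 Prop. 15 and §2.6] -/
theorem exists_galoisRepTorsion_eq_smul_of_not_surjective_three (hp3 : p = 3)
    (hirr : W.HasIrreducibleModPGaloisRep p) (hns : ¬ W.HasSurjectiveModNGaloisRep p) :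
    ∃ (σ : absoluteGaloisGroup ℚ) (a : ZMod p), a ≠ 1 ∧
      ∀ x : geomTorsion W p, Multiplicative.toAdd (galoisRepTorsion W p σ) x = a.val • x := by
  subst hp3
  obtain ⟨e, Φ, he, -, -, -, -⟩ := exists_frame_galoisRepTorsion_rat W 3
  set G : Subgroup (GL (Fin 2) (ZMod 3)) :=
    (galoisRepTorsion W (3 : ℕ)).range.map Φ.toMonoidHom with hG
  have hGtop : G ≠ ⊤ := fun h => hns ((map_range_galoisRepTorsion_eq_top_iff W 3 Φ).mp h)
  have hdetG : ∀ u : (ZMod 3)ˣ, ∃ g ∈ G, Matrix.GeneralLinearGroup.det g = u :=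
    exists_mem_map_range_det_eq W 3 Φ e he
  have hirrG : ∀ (v : Fin 2 → ZMod 3) (hv : v ≠ 0), ¬ G ≤ eigenvectorStabilizer v hv :=
    fun v hv => not_le_eigenvectorStabilizer_of_hasIrreducibleModPGaloisRep W 3 Φ e he hirr hv
  have hcard : ¬ 3 ∣ Nat.card G :=
    not_dvd_natCard_of_forall_not_le_eigenvectorStabilizer G hdetG hGtop hirrG
  obtain ⟨z, a, ha1, hz⟩ := exists_mat_eq_smul_one_ne_one_three G hcard hirrG
  -- `z = Φ(ρ̄ σ)` for some `σ`
  obtain ⟨g, ⟨σ, rfl⟩, hgz⟩ := z.2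
  refine ⟨σ, a, ha1, fun x => e.injective ?_⟩
  have hΦ : Φ (galoisRepTorsion W (3 : ℕ) σ) = z.1 := hgz
  have hmat : ((Φ (galoisRepTorsion W (3 : ℕ) σ) : GL (Fin 2) (ZMod 3)) :
      Matrix (Fin 2) (Fin 2) (ZMod 3)) = a • 1 := by
    rw [hΦ]
    exact hz
  rw [he, hmat, Matrix.smul_mulVec, Matrix.one_mulVec, map_nsmul,
    ← Nat.cast_smul_eq_nsmul (ZMod 3) a.val (e x), ZMod.natCast_zmod_val]

/-- **`3 ∤ #ρ̄_{E,3}(Γ_ℚ)` and a scalar `-1` in the image, packaged**: at an irreducible,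
non-surjective `3` the order of the mod-`3` image (in any frame) is prime to `3` — so
`ℚ(E[3]) ∩ ℚ(μ_{3^∞}) = ℚ(μ_3)` and `Ḡ ∩ SL₂(𝔽₃)` has no quotient of order `3` — which is the other
half of (F2) at `p = 3`. This is `not_dvd_natCard_of_forall_not_le_eigenvectorStabilizer` read for a
curve; recorded next to the scalar for the consumers of `KatoMuTransferThree`.
[cite: Serre1972, §2.4 Prop. 15] -/
theorem not_dvd_natCard_image_of_not_surjective_three (hp3 : p = 3)
    (hirr : W.HasIrreducibleModPGaloisRep p) (hns : ¬ W.HasSurjectiveModNGaloisRep p)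
    (e : geomTorsion W p ≃+ (Fin 2 → ZMod p))
    (Φ : Multiplicative (AddAut (geomTorsion W p)) ≃* GL (Fin 2) (ZMod p))
    (he : ∀ (g : Multiplicative (AddAut (geomTorsion W p))) (x : geomTorsion W p),
      e (Multiplicative.toAdd g x) =
        ((Φ g : GL (Fin 2) (ZMod p)) : Matrix (Fin 2) (Fin 2) (ZMod p)) *ᵥ e x) :
    ¬ p ∣ Nat.card ((galoisRepTorsion W p).range.map Φ.toMonoidHom) := by
  subst hp3
  set G : Subgroup (GL (Fin 2) (ZMod 3)) := (galoisRepTorsion W (3 : ℕ)).range.map Φ.toMonoidHom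
  have hGtop : G ≠ ⊤ := fun h => hns ((map_range_galoisRepTorsion_eq_top_iff W 3 Φ).mp h)
  have hdetG : ∀ u : (ZMod 3)ˣ, ∃ g ∈ G, Matrix.GeneralLinearGroup.det g = u :=
    exists_mem_map_range_det_eq W 3 Φ e he
  have hirrG : ∀ (v : Fin 2 → ZMod 3) (hv : v ≠ 0), ¬ G ≤ eigenvectorStabilizer v hv :=
    fun v hv => not_le_eigenvectorStabilizer_of_hasIrreducibleModPGaloisRep W 3 Φ e he hirr hv
  exact not_dvd_natCard_of_forall_not_le_eigenvectorStabilizer G hdetG hGtop hirrG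

end WeierstrassCurve
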